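import Mathlib
import Summits.PneNP.PneNP.Theorems.PstarGraphQuadGap

/-!
# The `P⋆` instance of a graph-quadratic system (ROUND-24 item T24.11b, part I: instance and parity algebra)

FRONTIER range-avoidance ladder (cell `pnp-ideate`, ROUND-24 gap-lemma programme; restricted-model combinatorics — nothing here bears
on `P` versus `NP`).

Towards `PstarGraphQuadGap.ReductionToPstar : PstarGapLemmaSO → GraphQuadGap` (closed in `PstarGraphQuadGapReduction`).  Given a
simple graph `E` on `Fin V`, the pure typed `P⋆` instance `inst E : LocalMap 4 (m + m + V) m` (`m = #E`): output `j` reads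
`(x_j, x'_j, a_p, a_q)` for the `j`-th edge `(p, q)` (any enumeration `edge E`), with FRESH XOR pairs.  Proved here: `isPure_inst`
(`p < q`), `typed_inst` (XOR variables below `2m`, AND variables from `2m` on), `simpleOverlap_inst` (two distinct increasing edges share
at most one endpoint; XOR variables are private), `maxDegree_inst : EdgeMaxDegree Δ E → MaxDegree (Δ+1) (inst E)` (XOR variables have
degree `1`), and `boundaryExpanding_inst r` for EVERY `r` (both XOR variables of an output are private, so `|bdry J| ≥ 2|J|`).
Plus the `xor`-sum algebra `bpar` (`bpar_union`, `bpar_insert`, `bpar_flip`, `bpar_map`, `bpar_biUnion_pair`) used by the semantic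
half; `PstarPDT.parity S z = bpar S z`.
-/

set_option linter.dupNamespace false -- `Summit.PneNP.PneNP.…`: summit = sub-problem name (D-0017 single-conjunct layout)

open Finset Literature.Computability.Complexity
open Summit.PneNP.PneNP.Theorems.PstarPDT (parity)
open Summit.PneNP.PneNP.Theorems.PstarTyped (Typed)
open Summit.PneNP.PneNP.Theorems.PstarSALevel (varSet bdry BoundaryExpanding SimpleOverlap)
open Summit.PneNP.PneNP.Theorems.PstarSAClosure (mem_bdry_iff degIn)
open Summit.PneNP.PneNP.Theorems.PstarGapLemma (Sat Feasible MinInfeasible GapBound MaxDegree PstarGapLemmaSO)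
open Summit.PneNP.PneNP.Theorems.PstarGraphQuadGap (Edge QCon qval QHolds Simple EdgeMaxDegree Supported Unsat EdgeMinimal
  GraphQuadGap ReductionToPstar)

namespace Summit.PneNP.PneNP.Theorems.PstarGraphQuadGapInstance

/-! ## Parity algebra -/

section Parity

variable {α : Type*}

/-- Parities add under `xor`. -/
theorem decide_odd_add (a b : ℕ) : decide (Odd (a + b)) = xor (decide (Odd a)) (decide (Odd b)) := by
  simp only [Nat.odd_iff]
  have hab : (a + b) % 2 = (a % 2 + b % 2) % 2 := Nat.add_mod _ _ _
  rcases Nat.mod_two_eq_zero_or_one a with ha | ha <;> rcases Nat.mod_two_eq_zero_or_one b with hb | hb <;>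
    simp [hab, ha, hb]

/-- The `xor`-sum of `f` over `s`: the parity of the number of `true`s. -/
def bpar (s : Finset α) (f : α → Bool) : Bool := decide (Odd (s.filter fun x => f x = true).card)

/-- `PstarPDT.parity` is a `bpar`. -/
theorem parity_eq_bpar {n : ℕ} (S : Finset (Fin n)) (z : Fin n → Bool) : parity S z = bpar S z := rfl

/-- `bpar` of a disjoint union. -/
theorem bpar_union [DecidableEq α] {s t : Finset α} (h : Disjoint s t) (f : α → Bool) : bpar (s ∪ t) f = xor (bpar s f) (bpar t f) := by
  unfold bpar
  rw [filter_union, card_union_of_disjoint (disjoint_filter_filter h), decide_odd_add]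

/-- `bpar` of a singleton. -/
theorem bpar_singleton [DecidableEq α] (a : α) (f : α → Bool) : bpar {a} f = f a := by
  unfold bpar
  rw [filter_singleton]
  cases f a <;> simp

/-- `bpar` of `insert`. -/
theorem bpar_insert [DecidableEq α] {a : α} {s : Finset α} (h : a ∉ s) (f : α → Bool) : bpar (insert a s) f = xor (f a) (bpar s f) := by
  rw [insert_eq, bpar_union (disjoint_singleton_left.2 h), bpar_singleton]

/-- `bpar` depends only on the values on `s`. -/
theorem bpar_congr {s : Finset α} {f g : α → Bool} (h : ∀ x ∈ s, f x = g x) : bpar s f = bpar s g := by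
  unfold bpar
  rw [filter_congr fun x hx => by rw [h x hx]]

/-- Flipping one value flips `bpar`. -/
theorem bpar_flip [DecidableEq α] {s : Finset α} {f g : α → Bool} {a : α} (ha : a ∈ s) (hfa : f a = !g a) (h : ∀ x ∈ s, x ≠ a → f x = g x) :
    bpar s f = !bpar s g := by
  rw [← insert_erase ha, bpar_insert (notMem_erase a s), bpar_insert (notMem_erase a s),
    bpar_congr fun x hx => h x (mem_of_mem_erase hx) (ne_of_mem_erase hx), hfa]
  cases g a <;> cases bpar (s.erase a) g <;> rfl

/-- `bpar` along an embedding. -/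
theorem bpar_map {β : Type*} [DecidableEq β] (e : α ↪ β) (s : Finset α) (f : β → Bool) :
    bpar (s.map e) f = bpar s (fun x => f (e x)) := by
  unfold bpar
  rw [filter_map, card_map]
  rfl

/-- `bpar` of a disjoint union of pairs is the `xor`-sum of the pair `xor`s. -/
theorem bpar_biUnion_pair [DecidableEq α] {β : Type*} [DecidableEq β] (u v : α → β) (huv : ∀ x, u x ≠ v x)
    (hinj : ∀ x x', x ≠ x' → Disjoint ({u x, v x} : Finset β) {u x', v x'}) (f : β → Bool) :
    ∀ s : Finset α, bpar (s.biUnion fun x => {u x, v x}) f = bpar s fun x => xor (f (u x)) (f (v x)) := by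
  intro s
  induction s using Finset.induction_on with
  | empty => simp [bpar]
  | insert a s has ih =>
    rw [biUnion_insert, bpar_union, ih, bpar_insert has, bpar_insert (by simp [huv a]), bpar_singleton]
    rw [disjoint_biUnion_right]
    exact fun x hx => hinj a x (fun h => has (h ▸ hx))

end Parity

/-! ## The instance of a graph -/

section Instance

variable {V : ℕ} (E : Finset (Edge V))

/-- The `j`-th edge (any fixed enumeration). -/
noncomputable def edge (j : Fin E.card) : Edge V := (E.equivFin.symm j).1

/-- The `j`-th edge is an edge. -/
theorem edge_mem (j : Fin E.card) : edge E j ∈ E := (E.equivFin.symm j).2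

/-- The enumeration is injective. -/
theorem edge_injective : Function.Injective (edge E) := fun _ _ h =>
  E.equivFin.symm.injective (Subtype.ext h)

/-- Every edge is enumerated. -/
theorem exists_edge_eq {e : Edge V} (he : e ∈ E) : ∃ j, edge E j = e :=
  ⟨E.equivFin ⟨e, he⟩, by simp [edge]⟩

/-- The XOR variable `x_j`. -/
def xv (j : Fin E.card) : Fin (E.card + E.card + V) := Fin.castAdd V (Fin.castAdd E.card j)

/-- The XOR variable `x'_j`. -/
def xv' (j : Fin E.card) : Fin (E.card + E.card + V) := Fin.castAdd V (Fin.natAdd E.card j)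

/-- The AND variable `a_v`. -/
def av (v : Fin V) : Fin (E.card + E.card + V) := Fin.natAdd (E.card + E.card) v

/-- Values of the three kinds of variables. -/
theorem xv_val (j : Fin E.card) : (xv E j).val = j.val := rfl

/-- Values of the three kinds of variables. -/
theorem xv'_val (j : Fin E.card) : (xv' E j).val = E.card + j.val := rfl

/-- Values of the three kinds of variables. -/
theorem av_val (v : Fin V) : (av E v).val = E.card + E.card + v.val := rfl

/-- `av` as an embedding. -/
def avEmb : Fin V ↪ Fin (E.card + E.card + V) := ⟨av E, Fin.natAdd_injective _ _⟩

/-- `xv` is injective. -/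
theorem xv_injective : Function.Injective (xv E) := fun _ _ h =>
  Fin.castAdd_injective _ _ (Fin.castAdd_injective _ _ h)

/-- `xv'` is injective. -/
theorem xv'_injective : Function.Injective (xv' E) := fun _ _ h =>
  Fin.natAdd_injective _ _ (Fin.castAdd_injective _ _ h)

/-- The slot map of output `j`: `(x_j, x'_j, a_p, a_q)` for the `j`-th edge `(p, q)`. -/
noncomputable def slot (j : Fin E.card) (s : Fin 4) : Fin (E.card + E.card + V) :=
  if s.val = 0 then xv E j else if s.val = 1 then xv' E j else if s.val = 2 then av E (edge E j).1 else av E (edge E j).2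

/-- **The instance**: output `j` reads `(x_j, x'_j, a_p, a_q)` for the `j`-th edge `(p, q)`, table `P⋆`. -/
noncomputable def inst : LocalMap 4 (E.card + E.card + V) E.card where
  vars := slot E
  table _ := xorAndPred

/-- Slot `0`. -/
theorem vars_zero (j : Fin E.card) : (inst E).vars j 0 = xv E j := rfl

/-- Slot `1`. -/
theorem vars_one (j : Fin E.card) : (inst E).vars j 1 = xv' E j := rfl

/-- Slot `2`. -/
theorem vars_two (j : Fin E.card) : (inst E).vars j 2 = av E (edge E j).1 := rfl

/-- Slot `3`. -/
theorem vars_three (j : Fin E.card) : (inst E).vars j 3 = av E (edge E j).2 := rfl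

variable {E}

/-- The four positions of an output are distinct (the graph is simple: `p < q`). -/
theorem vars_injective (hS : Simple E) (j : Fin E.card) : Function.Injective ((inst E).vars j) := by
  have hpq : (edge E j).1 < (edge E j).2 := hS _ (edge_mem E j)
  have h1 := Fin.lt_def.1 hpq
  intro s t h
  have hv := congrArg Fin.val h
  have hs : ∀ u : Fin 4, ((inst E).vars j u).val =
      if u.val = 0 then j.val else if u.val = 1 then E.card + j.val
      else if u.val = 2 then E.card + E.card + (edge E j).1.val else E.card + E.card + (edge E j).2.val := by
    intro u
    change (slot E j u).val = _
    unfold slot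
    split_ifs <;> rfl
  rw [hs s, hs t] at hv
  apply Fin.ext
  have := s.isLt
  have := t.isLt
  split_ifs at hv <;> omega

/-- The instance is pure `P⋆`. -/
theorem isPure_inst (hS : Simple E) : (inst E).IsPure xorAndPred := ⟨fun _ => rfl, vars_injective hS⟩

/-- The instance is typed (XOR variables below `2m`, AND variables from `2m` on). -/
theorem typed_inst : Typed (inst E) := by
  intro j j' s t hs ht h
  have hv := congrArg Fin.val h
  have hs' : s = 0 ∨ s = 1 := by fin_cases s <;> simp at hs ⊢
  have ht' : t = 2 ∨ t = 3 := by fin_cases t <;> simp at ht ⊢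
  rcases hs' with rfl | rfl <;> rcases ht' with rfl | rfl <;>
    simp only [vars_zero, vars_one, vars_two, vars_three, xv_val, xv'_val, av_val] at hv <;> omega

/-- Membership in the variable set of output `j`. -/
theorem mem_varSet_iff (j : Fin E.card) (w : Fin (E.card + E.card + V)) :
    w ∈ varSet (inst E) j ↔ w = xv E j ∨ w = xv' E j ∨ w = av E (edge E j).1 ∨ w = av E (edge E j).2 := by
  unfold PstarSALevel.varSet
  rw [mem_image]
  constructor
  · rintro ⟨s, -, hs⟩
    fin_cases s
    · exact Or.inl (hs ▸ (vars_zero E j).symm)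
    · exact Or.inr (Or.inl (hs ▸ (vars_one E j).symm))
    · exact Or.inr (Or.inr (Or.inl (hs ▸ (vars_two E j).symm)))
    · exact Or.inr (Or.inr (Or.inr (hs ▸ (vars_three E j).symm)))
  · rintro (rfl | rfl | rfl | rfl)
    · exact ⟨0, mem_univ _, vars_zero E j⟩
    · exact ⟨1, mem_univ _, vars_one E j⟩
    · exact ⟨2, mem_univ _, vars_two E j⟩
    · exact ⟨3, mem_univ _, vars_three E j⟩

/-- An AND variable belongs to output `j` iff it is an endpoint of the `j`-th edge. -/
theorem av_mem_varSet_iff (j : Fin E.card) (v : Fin V) :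
    av E v ∈ varSet (inst E) j ↔ (edge E j).1 = v ∨ (edge E j).2 = v := by
  rw [mem_varSet_iff]
  have h1 : av E v ≠ xv E j := fun h => by have := congrArg Fin.val h; simp [xv_val, av_val] at this; omega
  have h2 : av E v ≠ xv' E j := fun h => by have := congrArg Fin.val h; simp [xv'_val, av_val] at this; omega
  have h3 : ∀ u : Fin V, av E v = av E u ↔ u = v := fun u =>
    ⟨fun h => (Fin.natAdd_injective _ _ h).symm, fun h => by rw [h]⟩
  simp only [h1, h2, false_or, h3]

/-- An XOR variable `x_j` belongs to output `j'` iff `j' = j`. -/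
theorem xv_mem_varSet_iff (j j' : Fin E.card) : xv E j ∈ varSet (inst E) j' ↔ j' = j := by
  rw [mem_varSet_iff]
  constructor
  · rintro (h | h | h | h)
    · exact (Fin.castAdd_injective _ _ (Fin.castAdd_injective _ _ h)).symm
    all_goals (have := congrArg Fin.val h; simp [xv_val, xv'_val, av_val] at this; omega)
  · rintro rfl; exact Or.inl rfl

/-- An XOR variable `x'_j` belongs to output `j'` iff `j' = j`. -/
theorem xv'_mem_varSet_iff (j j' : Fin E.card) : xv' E j ∈ varSet (inst E) j' ↔ j' = j := by
  rw [mem_varSet_iff]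
  constructor
  · rintro (h | h | h | h)
    · have := congrArg Fin.val h; simp [xv_val, xv'_val] at this; omega
    · exact (Fin.natAdd_injective _ _ (Fin.castAdd_injective _ _ h)).symm
    all_goals (have := congrArg Fin.val h; simp [xv'_val, av_val] at this; omega)
  · rintro rfl; exact Or.inr (Or.inl rfl)

/-- **Simple overlaps**: two distinct outputs share at most one variable (an endpoint of two distinct increasing edges). -/
theorem simpleOverlap_inst (hS : Simple E) : SimpleOverlap (inst E) := by
  intro j j' hne
  -- the common variables are AND variables of common endpoints
  have hsub : varSet (inst E) j ∩ varSet (inst E) j' ⊆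
      ({av E (edge E j).1, av E (edge E j).2} : Finset _) ∩ {av E (edge E j').1, av E (edge E j').2} := by
    intro w hw
    rw [mem_inter] at hw ⊢
    rw [mem_varSet_iff] at hw
    obtain ⟨h1, h2⟩ := hw
    rcases h1 with rfl | rfl | rfl | rfl
    · exact absurd ((xv_mem_varSet_iff j j').1 h2) hne.symm
    · exact absurd ((xv'_mem_varSet_iff j j').1 h2) hne.symm
    · rw [av_mem_varSet_iff] at h2
      refine ⟨by simp, ?_⟩
      rcases h2 with h | h
      · rw [← h]; simp
      · rw [← h]; simp
    · rw [av_mem_varSet_iff] at h2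
      refine ⟨by simp, ?_⟩
      rcases h2 with h | h
      · rw [← h]; simp
      · rw [← h]; simp
  refine (card_le_card hsub).trans ?_
  by_contra hlt
  push Not at hlt
  -- two common endpoints force the same edge
  have hp := hS _ (edge_mem E j)
  have hp' := hS _ (edge_mem E j')
  set A : Finset (Fin (E.card + E.card + V)) := {av E (edge E j).1, av E (edge E j).2} with hA
  set B : Finset (Fin (E.card + E.card + V)) := {av E (edge E j').1, av E (edge E j').2} with hB
  have hAc : A.card ≤ 2 := card_insert_le _ _
  have hAB : A ∩ B = A := eq_of_subset_of_card_le inter_subset_left (by omega)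
  have hBA : A ∩ B = B := eq_of_subset_of_card_le inter_subset_right (by
    have : B.card ≤ 2 := card_insert_le _ _; omega)
  have hEq : A = B := hAB.symm.trans hBA
  have m1 : av E (edge E j).1 ∈ B := by rw [← hEq]; simp [hA]
  have m2 : av E (edge E j).2 ∈ B := by rw [← hEq]; simp [hA]
  rw [hB, mem_insert, mem_singleton] at m1 m2
  have inj : ∀ u w : Fin V, av E u = av E w → u = w := fun u w h => Fin.natAdd_injective _ _ h
  have e1 := Fin.lt_def.1 hp
  have e2 := Fin.lt_def.1 hp'
  rcases m1 with m1 | m1 <;> rcases m2 with m2 | m2 <;>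
    have a1 := congrArg Fin.val (inj _ _ m1) <;> have a2 := congrArg Fin.val (inj _ _ m2)
  · omega
  · apply hne
    apply edge_injective E
    exact Prod.ext (Fin.ext a1) (Fin.ext a2)
  · omega
  · omega

/-- **Maximum degree `Δ + 1`** (AND variables lie on `≤ Δ` edges, XOR variables in one output). -/
theorem maxDegree_inst {Δ : ℕ} (hΔ : EdgeMaxDegree Δ E) : MaxDegree (Δ + 1) (inst E) := by
  intro w
  by_cases hw : ∃ v, w = av E v
  · obtain ⟨v, rfl⟩ := hw
    have h : (univ.filter fun j : Fin E.card => av E v ∈ varSet (inst E) j).card ≤ (E.filter fun e => e.1 = v ∨ e.2 = v).card := by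
      refine card_le_card_of_injOn (edge E) (fun j hj => ?_) (fun j _ j' _ h => edge_injective E h)
      rw [mem_coe, mem_filter] at hj
      rw [mem_coe, mem_filter]
      exact ⟨edge_mem E j, (av_mem_varSet_iff j v).1 hj.2⟩
    exact h.trans ((hΔ v).trans (Nat.le_succ _))
  · -- an XOR variable (or out of range): at most one output reads it
    push Not at hw
    have h1 : (univ.filter fun j : Fin E.card => w ∈ varSet (inst E) j).card ≤ 1 := by
      rw [card_le_one]
      intro j hj j' hj'
      rw [mem_filter] at hj hj'
      rw [mem_varSet_iff] at hj hj'
      obtain ⟨-, hj⟩ := hj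
      obtain ⟨-, hj'⟩ := hj'
      rcases hj with rfl | rfl | h | h
      · rcases hj' with h' | h' | h' | h'
        · exact Fin.castAdd_injective _ _ (Fin.castAdd_injective _ _ h')
        · have := congrArg Fin.val h'; simp [xv_val, xv'_val] at this; omega
        · exact absurd h' (hw _)
        · exact absurd h' (hw _)
      · rcases hj' with h' | h' | h' | h'
        · have := congrArg Fin.val h'; simp [xv_val, xv'_val] at this; omega
        · exact Fin.natAdd_injective _ _ (Fin.castAdd_injective _ _ h')
        · exact absurd h' (hw _)
        · exact absurd h' (hw _)
      · exact absurd h (hw _)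
      · exact absurd h (hw _)
    omega

/-- **Boundary expansion for every radius**: both XOR variables of an output are private. -/
theorem boundaryExpanding_inst (r : ℕ) : BoundaryExpanding r (inst E) := by
  classical
  intro J _
  have hsub : J.image (xv E) ∪ J.image (xv' E) ⊆ bdry (inst E) J := by
    intro w hw
    rw [mem_bdry_iff]
    unfold PstarSAClosure.degIn
    rw [mem_union, mem_image, mem_image] at hw
    rcases hw with ⟨j, hj, rfl⟩ | ⟨j, hj, rfl⟩
    · rw [card_eq_one]
      exact ⟨j, by ext j'; rw [mem_filter, mem_singleton, xv_mem_varSet_iff]; exact ⟨fun h => h.2, fun h => ⟨h ▸ hj, h⟩⟩⟩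
    · rw [card_eq_one]
      exact ⟨j, by ext j'; rw [mem_filter, mem_singleton, xv'_mem_varSet_iff]; exact ⟨fun h => h.2, fun h => ⟨h ▸ hj, h⟩⟩⟩
  have hdisj : Disjoint (J.image (xv E)) (J.image (xv' E)) := by
    rw [disjoint_left]
    rintro w hw hw'
    obtain ⟨j, -, rfl⟩ := mem_image.1 hw
    obtain ⟨j', -, h⟩ := mem_image.1 hw'
    have := congrArg Fin.val h; simp [xv_val, xv'_val] at this; omega
  have hc := card_le_card hsub
  rw [card_union_of_disjoint hdisj, card_image_of_injective _ (xv_injective E), card_image_of_injective _ (xv'_injective E)] at hc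
  omega

end Instance

end Summit.PneNP.PneNP.Theorems.PstarGraphQuadGapInstance
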